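import Mathlib
import Summits.CriticalPhenomena.CardyFormulaZ2.Theorems.CardySelfRefinementGradientComparabilityStubLayerBridgeTransferChain
import HarnessLib

/-!
# Boundary-layer surgery, brick (S5), part III: the bridge transfer in the stub's currency

Helper file of the registered stub `stub_layerLocalModification` (the deterministic
boundary-layer surgery) of the line `monotone-product-coordinates` (crux
`stmt-CriticalPhenomena-10269`, `…Theses.CardySelfRefinement.GradientComparability`), step (S5),
axial bookkeeping on top of the chain form `layer_bridgeTransfer_chain` (part II):
`layer_bridgeTransfer_of_cellContact` (registered helper).

For `k = 2, 3` and an AXIAL edge `e = edgeOf (v, d)` (its line is a coarse line of `kℤ²`)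
satisfying the hypotheses of the cell-contact lemma (single quad, mesh `η√2 < 1`, closed
segment in `[Q]` off `∂₀Q ∪ ∂₂Q`, open segment in `[Q]°`, `3η√2 ≤ dist (∂₁Q, ∂₃Q)`,
`5η√2 ≤ dist (∂₀Q, ∂₂Q)`, NO ROOM, NOT DEAD) and pivotal for `Aloc 1 ![Q] η` in `ω`, the chain
form makes an edge `t` of a contact path `x → x + n → x' + n → x'` (`{x, x'} = {v, v + e_d}`,
`n = ± e_{1-d}`) pivotal in a configuration `(ω ∖ {e}) ∪ S`, `S ⊆` {the other path edges}.
The rail `{x + n, x' + n}` lies one row off the coarse line of `e`, hence is never axial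
(`adm_rail`); the post at an end `z` of `e` is axial iff `k ∣ z d` (`adm_post`), and since
`x' d = x d ± 1` at most one of the two posts is axial.  Running the chain in both orders
therefore yields the conclusion of `stub_layerLocalModification` for this `e` (with `R = 4`,
`Rm = {e}`), UNLESS the post `{z, z + n}` at a coarse end `z` (`k ∣ z d`) is by itself pivotal in
`ω ∖ {e}` — the residual case, returned as the second alternative (a pivotal axial post
perpendicular to `e` at its coarse vertex; see the line's layer-topology report, §wave7B).
No percolation, no named fact.
-/

noncomputable section

namespace Summit.CriticalPhenomena.CardyFormulaZ2.Theorems.CardySelfRefinement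

open scoped Topology
open Filter Set MeasureTheory
open Literature.Probability.LatticeModels Literature.Probability.Percolation
open Literature.Probability.Percolation.QuadCrossing
open Summit.CriticalPhenomena.CardyFormulaZ2.Theses.CardySelfRefinement

/-- **The unit normals of an edge of the standard frame.**  If `{x, x'} = {v, v + e_d}` and
`x + n` is a neighbour of `x` with `x ± n ≠ x'`, then `n = ± e_{1-d}`. -/
theorem normal_eq_smul_dirVec {v n x x' : Site 2} {d : Fin 2}
    (hor : x = v ∧ x' = v + dirVec d ∨ x = v + dirVec d ∧ x' = v)
    (hxn : (zdGraph 2).Adj x (x + n)) (hne : x + n ≠ x') (hne' : x - n ≠ x') :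
    ∃ t : ℤ, (t = 1 ∨ t = -1) ∧ n = t • dirVec (1 - d) := by
  have hk : ∀ i : Fin 2, i = 0 ∨ i = 1 := by decide
  rw [zdGraph_two_adj_iff] at hxn
  simp only [Pi.add_apply] at hxn
  have hn : (n 0 = 1 ∧ n 1 = 0) ∨ (n 0 = -1 ∧ n 1 = 0) ∨ (n 0 = 0 ∧ n 1 = 1) ∨
      (n 0 = 0 ∧ n 1 = -1) := by omega
  have hne0 : ¬ (n 0 = x' 0 - x 0 ∧ n 1 = x' 1 - x 1) := fun h => hne (funext fun i => by
    rcases hk i with rfl | rfl <;> simp only [Pi.add_apply] <;> omega)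
  have hne1 : ¬ (-n 0 = x' 0 - x 0 ∧ -n 1 = x' 1 - x 1) := fun h => hne' (funext fun i => by
    rcases hk i with rfl | rfl <;> simp only [Pi.sub_apply] <;> omega)
  have hd : d = 0 ∨ d = 1 := by rcases hk d with h | h <;> [exact Or.inl h; exact Or.inr h]
  have hΔ : (d = 0 → (x' 0 - x 0 = 1 ∨ x' 0 - x 0 = -1) ∧ x' 1 - x 1 = 0) ∧
      (d = 1 → x' 0 - x 0 = 0 ∧ (x' 1 - x 1 = 1 ∨ x' 1 - x 1 = -1)) := by
    rcases hor with ⟨rfl, rfl⟩ | ⟨rfl, rfl⟩ <;> rcases hd with rfl | rfl <;>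
      simp [dirVec]
  rcases hd with rfl | rfl
  · obtain ⟨h0, h1⟩ := hΔ.1 rfl
    have h10 : (1 : Fin 2) - 0 = 1 := rfl
    rw [h10]
    rcases hn with ⟨a, b⟩ | ⟨a, b⟩ | ⟨a, b⟩ | ⟨a, b⟩
    · exfalso; rcases h0 with h0 | h0
      exacts [hne0 ⟨by omega, by omega⟩, hne1 ⟨by omega, by omega⟩]
    · exfalso; rcases h0 with h0 | h0
      exacts [hne1 ⟨by omega, by omega⟩, hne0 ⟨by omega, by omega⟩]
    · exact ⟨1, Or.inl rfl, funext fun i => by rcases hk i with rfl | rfl <;> simp [dirVec, a, b]⟩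
    · exact ⟨-1, Or.inr rfl, funext fun i => by rcases hk i with rfl | rfl <;> simp [dirVec, a, b]⟩
  · obtain ⟨h0, h1⟩ := hΔ.2 rfl
    have h11 : (1 : Fin 2) - 1 = 0 := rfl
    rw [h11]
    rcases hn with ⟨a, b⟩ | ⟨a, b⟩ | ⟨a, b⟩ | ⟨a, b⟩
    · exact ⟨1, Or.inl rfl, funext fun i => by rcases hk i with rfl | rfl <;> simp [dirVec, a, b]⟩
    · exact ⟨-1, Or.inr rfl, funext fun i => by rcases hk i with rfl | rfl <;> simp [dirVec, a, b]⟩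
    · exfalso; rcases h1 with h1 | h1
      exacts [hne0 ⟨by omega, by omega⟩, hne1 ⟨by omega, by omega⟩]
    · exfalso; rcases h1 with h1 | h1
      exacts [hne1 ⟨by omega, by omega⟩, hne0 ⟨by omega, by omega⟩]

/-- **Bridge transfer in the currency of `stub_layerLocalModification`** (brick (S5) of the
boundary-layer surgery; registered helper).  `k = 2` or `3`, single quad `Q`, mesh `η√2 < 1`,
`A = Aloc 1 ![Q] η`, `e = edgeOf (v, d)` AXIAL with the hypotheses of the cell-contact lemma
(closed segment in `[Q]` off `∂₀Q ∪ ∂₂Q`, open segment in `[Q]°`, `3η√2 ≤ dist (∂₁Q, ∂₃Q)`,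
`5η√2 ≤ dist (∂₀Q, ∂₂Q)`, NO ROOM, NOT DEAD) and pivotal for `A` in `ω`.  Then EITHER some
NON-AXIAL edge `e' = edgeOf (v', d')` within four lattice steps of `v` is pivotal for `A` in a
configuration `(ω ∖ Rm) ∪ S`, `Rm ∪ S` genuine lattice edges within four steps of `v` (in fact
`Rm = {e}` and `S` at most two edges of the cell beside `e`) — the conclusion of the stub for
this edge — OR (residual case) for a COARSE end `z` of `e` (`k ∣ z d`: the lattice line across
`e` through `z` is a coarse line, so `z` is a coarse vertex) and a unit normal `n` of `e`, the
axial post `{z, z + n}` is pivotal for `A` already in `ω ∖ {e}`. -/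
theorem layer_bridgeTransfer_of_cellContact : ∀ (k : ℕ), k = 2 ∨ k = 3 → ∀ (η : ℝ), 0 < η → η * Real.sqrt 2 < 1 → ∀ (Q : Quad (Set.univ : Set ℂ)) (v : Site 2) (d : Fin 2) (ω : BondConfig (Site 2)), ax k (v, d) → segment ℝ (meshPoint (η * Real.sqrt 2) v) (meshPoint (η * Real.sqrt 2) (v + dirVec d)) ⊆ Q.carrier → openSegment ℝ (meshPoint (η * Real.sqrt 2) v) (meshPoint (η * Real.sqrt 2) (v + dirVec d)) ⊆ interior Q.carrier → Disjoint (segment ℝ (meshPoint (η * Real.sqrt 2) v) (meshPoint (η * Real.sqrt 2) (v + dirVec d))) (Q.side 0 ∪ Q.side 2) → (∀ z ∈ Q.side 1, ∀ w ∈ Q.side 3, 3 * (η * Real.sqrt 2) ≤ dist z w) → (∀ z ∈ Q.side 0, ∀ w ∈ Q.side 2, 5 * (η * Real.sqrt 2) ≤ dist z w) → (∀ n : Site 2, (zdGraph 2).Adj v (v + n) → v + n ≠ v + dirVec d → v - n ≠ v + dirVec d → ¬ (segment ℝ (meshPoint (η * Real.sqrt 2) v) (meshPoint (η * Real.sqrt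 2) (v + n)) ∪ segment ℝ (meshPoint (η * Real.sqrt 2) (v + n)) (meshPoint (η * Real.sqrt 2) (v + dirVec d + n)) ∪ segment ℝ (meshPoint (η * Real.sqrt 2) (v + dirVec d + n)) (meshPoint (η * Real.sqrt 2) (v + dirVec d)) ⊆ Q.carrier)) → (∀ (β : Set ℂ) (a b m : ℂ) (ρ : ℝ), m ∈ openSegment ℝ (meshPoint (η * Real.sqrt 2) v) (meshPoint (η * Real.sqrt 2) (v + dirVec d)) → Literature.Topology.PlaneTopology.IsSimpleArc β a b → a ∉ Q.side 0 ∪ Q.side 2 → b ∉ Q.side 0 ∪ Q.side 2 → β \ {a, b} ⊆ interior Q.carrier → β ∩ openEdgeUnion (η * Real.sqrt 2) Set.univ ⊆ {m} → 0 < ρ → Metric.ball m ρ ⊆ interior Q.carrier → β ∩ Metric.ball m ρ = Metric.ball m ρ ∩ {z | inner ℝ (z - m) (meshPoint (η * Real.sqrt 2) (v + dirVec d) - meshPoint (η * Real.sqrt 2) v) = 0} → ¬ (a ∈ Q.side 1 ∧ b ∈ Q.side 1 ∨ a ∈ Q.side 3 ∧ b ∈ Q.side 3)) → IsPivotal (Aloc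 1 ![Q] η) (edgeOf (v, d)) ω → (∃ (Rm S : Set (Sym2 (Site 2))) (e' : Sym2 (Site 2)), (∃ (v' : Site 2) (d' : Fin 2), e' = edgeOf (v', d') ∧ ¬ ax k (v', d') ∧ ∀ i, |v' i - v i| ≤ 4) ∧ (∀ x ∈ Rm ∪ S, ∃ a b : Site 2, x = s(a, b) ∧ (zdGraph 2).Adj a b ∧ ∀ i, |a i - v i| ≤ 4 ∧ |b i - v i| ≤ 4) ∧ IsPivotal (Aloc 1 ![Q] η) e' ((ω \ Rm) ∪ S)) ∨ (∃ (z z' n : Site 2), (z = v ∧ z' = v + dirVec d ∨ z = v + dirVec d ∧ z' = v) ∧ (k : ℤ) ∣ z d ∧ (zdGraph 2).Adj z (z + n) ∧ z + n ≠ z' ∧ z - n ≠ z' ∧ IsPivotal (Aloc 1 ![Q] η) s(z, z + n) (ω \ {edgeOf (v, d)})) := by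
  intro k hk η hη hη1 Q v d ω hax hseg hopen h02 hdist13 hdist02 hroom hND hpiv
  set V : ℤ → ℤ → Site 2 := fun a b => v + a • dirVec d + b • dirVec (1 - d) with hVdef
  have hV : ∀ a b, V a b = v + a • dirVec d + b • dirVec (1 - d) := fun _ _ => rfl
  have hadj : (zdGraph 2).Adj v (v + dirVec d) := by
    have := frame_adj hV (frame_std d) (a := 0) (b := 0) (a' := 1) (b' := 0) (by norm_num)
    simpa [hV] using this
  have hE : (edgeOf (v, d) : Sym2 (Site 2)) = s(v, v + dirVec d) := rfl
  rw [hE] at hpiv ⊢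
  obtain ⟨x, x', n, j, a, hor, hxn, hne, hne', -, -, -, hout⟩ := layer_bridgeTransfer_chain η hη
    hη1 Q v (v + dirVec d) ω hadj hseg hopen h02 hdist13 hdist02 hroom hND hpiv
  obtain ⟨t, ht, hnt⟩ := normal_eq_smul_dirVec hor hxn hne hne'
  -- the ends and the path vertices in the frame
  obtain ⟨i₀, i₁, hi, hxV, hx'V⟩ : ∃ i₀ i₁ : ℤ, (i₀ = 0 ∧ i₁ = 1 ∨ i₀ = 1 ∧ i₁ = 0) ∧
      x = V i₀ 0 ∧ x' = V i₁ 0 := by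
    rcases hor with ⟨rfl, rfl⟩ | ⟨rfl, rfl⟩
    · exact ⟨0, 1, Or.inl ⟨rfl, rfl⟩, by simp [hV], by simp [hV]⟩
    · exact ⟨1, 0, Or.inr ⟨rfl, rfl⟩, by simp [hV], by simp [hV]⟩
  have hi₀ : i₀ = 0 ∨ i₀ = 1 := hi.elim (fun h => Or.inl h.1) fun h => Or.inr h.1
  have hi₁ : i₁ = 0 ∨ i₁ = 1 := hi.elim (fun h => Or.inr h.2) fun h => Or.inl h.2
  have hxn' : x + n = V i₀ t := by rw [hxV, hnt, hV, hV]; simp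
  have hx'n : x' + n = V i₁ t := by rw [hx'V, hnt, hV, hV]; simp
  have hdd : ∀ d' : Fin 2, dirVec d' d' = 1 ∧ dirVec (1 - d') d' = 0 := by
    intro d'; fin_cases d' <;> simp [dirVec]
  have hxd : x d = v d + i₀ := by
    rw [hxV, hV]
    simp only [Pi.add_apply, Pi.smul_apply, smul_eq_mul, (hdd d).1, (hdd d).2]
    ring
  have hx'd : x' d = v d + i₁ := by
    rw [hx'V, hV]
    simp only [Pi.add_apply, Pi.smul_apply, smul_eq_mul, (hdd d).1, (hdd d).2]
    ring
  have hax' : (k : ℤ) ∣ v (if d = 0 then 1 else 0) := hax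
  -- admissible (non-axial, `edgeOf`-shaped, near `v`) edges: the rail always, a post off the
  -- coarse lines
  have rail_adm : ∃ (v' : Site 2) (d' : Fin 2), s(x + n, x' + n) = edgeOf (v', d') ∧
      ¬ ax k (v', d') ∧ ∀ i, |v' i - v i| ≤ 4 := by
    rw [hxn', hx'n]
    obtain ⟨v', d', h1, h2, h3⟩ :=
      adm_rail hk hV hax' (a := 0) (a' := 1) (t := t) (by norm_num) ht (by norm_num)
    rcases hi with ⟨rfl, rfl⟩ | ⟨rfl, rfl⟩
    · exact ⟨v', d', h1, h2, h3⟩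
    · exact ⟨v', d', by rw [Sym2.eq_swap]; exact h1, h2, h3⟩
  have post_adm : ∀ i : ℤ, (i = 0 ∨ i = 1) → ¬ (k : ℤ) ∣ v d + i →
      ∃ (v' : Site 2) (d' : Fin 2), s(V i 0, V i t) = edgeOf (v', d') ∧ ¬ ax k (v', d') ∧
        ∀ l, |v' l - v l| ≤ 4 := by
    intro i hi hni
    have hia : |i| ≤ 3 := by rcases hi with rfl | rfl <;> norm_num
    rcases ht with rfl | rfl
    · exact adm_post hV (a := i) (b := 0) (b' := 1) (by norm_num) hni hia (by norm_num)
    · obtain ⟨v', d', h1, h2, h3⟩ :=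
        adm_post hV (a := i) (b := -1) (b' := 0) (by norm_num) hni hia (by norm_num)
      exact ⟨v', d', by rw [Sym2.eq_swap]; exact h1, h2, h3⟩
  have post₁_adm : ¬ (k : ℤ) ∣ x d → ∃ (v' : Site 2) (d' : Fin 2),
      s(x, x + n) = edgeOf (v', d') ∧ ¬ ax k (v', d') ∧ ∀ l, |v' l - v l| ≤ 4 := fun h => by
    rw [hxn', hxV]
    exact post_adm i₀ hi₀ (by rwa [hxd] at h)
  have post₃_adm : ¬ (k : ℤ) ∣ x' d → ∃ (v' : Site 2) (d' : Fin 2),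
      s(x' + n, x') = edgeOf (v', d') ∧ ¬ ax k (v', d') ∧ ∀ l, |v' l - v l| ≤ 4 := fun h => by
    rw [Sym2.eq_swap, hx'n, hx'V]
    exact post_adm i₁ hi₁ (by rwa [hx'd] at h)
  have hnot_both : (k : ℤ) ∣ x d → ¬ (k : ℤ) ∣ x' d := by
    intro h h'
    rw [hxd] at h
    rw [hx'd] at h'
    rcases hk with rfl | rfl <;> rcases hi with ⟨rfl, rfl⟩ | ⟨rfl, rfl⟩ <;> omega
  -- every edge touched is a genuine edge within four steps of `v`
  have ht1 : |t| ≤ 1 := by rcases ht with rfl | rfl <;> norm_num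
  have hcoord : ∀ a b : ℤ, |a| ≤ 1 → |b| ≤ 1 → ∀ l, |V a b l - v l| ≤ 4 := fun a b ha hb l =>
    (frame_coord_le hV (frame_std d) a b l).trans (by linarith)
  have hci₀ : |i₀| ≤ 1 := by rcases hi₀ with rfl | rfl <;> norm_num
  have hci₁ : |i₁| ≤ 1 := by rcases hi₁ with rfl | rfl <;> norm_num
  have hgen : ∀ f ∈ ({s(v, v + dirVec d), s(x, x + n), s(x + n, x' + n), s(x' + n, x')} :
      Set (Sym2 (Site 2))), ∃ a b : Site 2, f = s(a, b) ∧ (zdGraph 2).Adj a b ∧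
        ∀ l, |a l - v l| ≤ 4 ∧ |b l - v l| ≤ 4 := by
    intro f hf
    simp only [mem_insert_iff, mem_singleton_iff] at hf
    rcases hf with rfl | rfl | rfl | rfl
    · refine ⟨v, v + dirVec d, rfl, hadj, fun l => ⟨by simp, ?_⟩⟩
      exact (abs_add_dirVec_sub_le v d l).trans (by norm_num)
    · refine ⟨x, x + n, rfl, hxn, fun l => ⟨?_, ?_⟩⟩
      · rw [hxV]; exact hcoord _ _ hci₀ (by norm_num) l
      · rw [hxn']; exact hcoord _ _ hci₀ ht1 l
    · refine ⟨x + n, x' + n, rfl, LocalParafermionicTemplate.zdGraph_adj_add_right ?_ n,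
        fun l => ⟨?_, ?_⟩⟩
      · rcases hor with ⟨rfl, rfl⟩ | ⟨rfl, rfl⟩
        exacts [hadj, hadj.symm]
      · rw [hxn']; exact hcoord _ _ hci₀ ht1 l
      · rw [hx'n]; exact hcoord _ _ hci₁ ht1 l
    · refine ⟨x' + n, x', rfl, ?_, fun l => ⟨?_, ?_⟩⟩
      · have := LocalParafermionicTemplate.zdGraph_adj_add_right hxn (x' - x)
        refine ((?_ : (zdGraph 2).Adj x' (x' + n))).symm
        convert this using 1 <;> abel
      · rw [hx'n]; exact hcoord _ _ hci₁ ht1 l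
      · rw [hx'V]; exact hcoord _ _ hci₁ (by norm_num) l
  -- packaging
  have good : ∀ (S : Set (Sym2 (Site 2))) (e' : Sym2 (Site 2)),
      S ⊆ {s(x, x + n), s(x + n, x' + n), s(x' + n, x')} →
      (∃ (v' : Site 2) (d' : Fin 2), e' = edgeOf (v', d') ∧ ¬ ax k (v', d') ∧
        ∀ i, |v' i - v i| ≤ 4) →
      IsPivotal (Aloc 1 ![Q] η) e' (ω \ {s(v, v + dirVec d)} ∪ S) →
      (∃ (Rm S : Set (Sym2 (Site 2))) (e' : Sym2 (Site 2)), (∃ (v' : Site 2) (d' : Fin 2),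
        e' = edgeOf (v', d') ∧ ¬ ax k (v', d') ∧ ∀ i, |v' i - v i| ≤ 4) ∧
        (∀ x ∈ Rm ∪ S, ∃ a b : Site 2, x = s(a, b) ∧ (zdGraph 2).Adj a b ∧
          ∀ i, |a i - v i| ≤ 4 ∧ |b i - v i| ≤ 4) ∧
        IsPivotal (Aloc 1 ![Q] η) e' ((ω \ Rm) ∪ S)) ∨
      (∃ (z z' n : Site 2), (z = v ∧ z' = v + dirVec d ∨ z = v + dirVec d ∧ z' = v) ∧
        (k : ℤ) ∣ z d ∧ (zdGraph 2).Adj z (z + n) ∧ z + n ≠ z' ∧ z - n ≠ z' ∧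
        IsPivotal (Aloc 1 ![Q] η) s(z, z + n) (ω \ {s(v, v + dirVec d)})) := by
    intro S e' hS hadm hp
    refine Or.inl ⟨{s(v, v + dirVec d)}, S, e', hadm, fun f hf => hgen f ?_, hp⟩
    rcases hf with hf | hf
    · exact Or.inl hf
    · exact Or.inr (hS hf)
  have good₀ : ∀ e' : Sym2 (Site 2), (∃ (v' : Site 2) (d' : Fin 2), e' = edgeOf (v', d') ∧
      ¬ ax k (v', d') ∧ ∀ i, |v' i - v i| ≤ 4) →
      IsPivotal (Aloc 1 ![Q] η) e' (ω \ {s(v, v + dirVec d)}) →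
      (∃ (Rm S : Set (Sym2 (Site 2))) (e' : Sym2 (Site 2)), (∃ (v' : Site 2) (d' : Fin 2),
        e' = edgeOf (v', d') ∧ ¬ ax k (v', d') ∧ ∀ i, |v' i - v i| ≤ 4) ∧
        (∀ x ∈ Rm ∪ S, ∃ a b : Site 2, x = s(a, b) ∧ (zdGraph 2).Adj a b ∧
          ∀ i, |a i - v i| ≤ 4 ∧ |b i - v i| ≤ 4) ∧
        IsPivotal (Aloc 1 ![Q] η) e' ((ω \ Rm) ∪ S)) ∨
      (∃ (z z' n : Site 2), (z = v ∧ z' = v + dirVec d ∨ z = v + dirVec d ∧ z' = v) ∧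
        (k : ℤ) ∣ z d ∧ (zdGraph 2).Adj z (z + n) ∧ z + n ≠ z' ∧ z - n ≠ z' ∧
        IsPivotal (Aloc 1 ![Q] η) s(z, z + n) (ω \ {s(v, v + dirVec d)})) :=
    fun e' hadm hp => good ∅ e' (empty_subset _) hadm (by rwa [Set.union_empty])
  have hm₁ : s(x, x + n) ∈ ({s(x, x + n), s(x + n, x' + n), s(x' + n, x')} : Set (Sym2 (Site 2))) :=
    mem_insert _ _
  have hm₂ : s(x + n, x' + n) ∈ ({s(x, x + n), s(x + n, x' + n), s(x' + n, x')} :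
      Set (Sym2 (Site 2))) := mem_insert_of_mem _ (mem_insert _ _)
  have hm₃ : s(x' + n, x') ∈ ({s(x, x + n), s(x + n, x' + n), s(x' + n, x')} :
      Set (Sym2 (Site 2))) := mem_insert_of_mem _ (mem_insert_of_mem _ (mem_singleton _))
  have residx : (k : ℤ) ∣ x d →
      IsPivotal (Aloc 1 ![Q] η) s(x, x + n) (ω \ {s(v, v + dirVec d)}) →
      (∃ (Rm S : Set (Sym2 (Site 2))) (e' : Sym2 (Site 2)), (∃ (v' : Site 2) (d' : Fin 2),
        e' = edgeOf (v', d') ∧ ¬ ax k (v', d') ∧ ∀ i, |v' i - v i| ≤ 4) ∧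
        (∀ x ∈ Rm ∪ S, ∃ a b : Site 2, x = s(a, b) ∧ (zdGraph 2).Adj a b ∧
          ∀ i, |a i - v i| ≤ 4 ∧ |b i - v i| ≤ 4) ∧
        IsPivotal (Aloc 1 ![Q] η) e' ((ω \ Rm) ∪ S)) ∨
      (∃ (z z' n : Site 2), (z = v ∧ z' = v + dirVec d ∨ z = v + dirVec d ∧ z' = v) ∧
        (k : ℤ) ∣ z d ∧ (zdGraph 2).Adj z (z + n) ∧ z + n ≠ z' ∧ z - n ≠ z' ∧
        IsPivotal (Aloc 1 ![Q] η) s(z, z + n) (ω \ {s(v, v + dirVec d)})) := fun hx hp => Or.inr ⟨x, x', n, hor, hx, hxn, hne, hne', hp⟩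
  have residx' : (k : ℤ) ∣ x' d →
      IsPivotal (Aloc 1 ![Q] η) s(x' + n, x') (ω \ {s(v, v + dirVec d)}) →
      (∃ (Rm S : Set (Sym2 (Site 2))) (e' : Sym2 (Site 2)), (∃ (v' : Site 2) (d' : Fin 2),
        e' = edgeOf (v', d') ∧ ¬ ax k (v', d') ∧ ∀ i, |v' i - v i| ≤ 4) ∧
        (∀ x ∈ Rm ∪ S, ∃ a b : Site 2, x = s(a, b) ∧ (zdGraph 2).Adj a b ∧
          ∀ i, |a i - v i| ≤ 4 ∧ |b i - v i| ≤ 4) ∧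
        IsPivotal (Aloc 1 ![Q] η) e' ((ω \ Rm) ∪ S)) ∨
      (∃ (z z' n : Site 2), (z = v ∧ z' = v + dirVec d ∨ z = v + dirVec d ∧ z' = v) ∧
        (k : ℤ) ∣ z d ∧ (zdGraph 2).Adj z (z + n) ∧ z + n ≠ z' ∧ z - n ≠ z' ∧
        IsPivotal (Aloc 1 ![Q] η) s(z, z + n) (ω \ {s(v, v + dirVec d)})) := by
    intro hx' hp
    refine Or.inr ⟨x', x, n, hor.elim (fun h => Or.inr ⟨h.2, h.1⟩) (fun h => Or.inl ⟨h.2, h.1⟩),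
      hx', ?_, fun h => hne' ?_, fun h => hne ?_, by rwa [Sym2.eq_swap]⟩
    · have := LocalParafermionicTemplate.zdGraph_adj_add_right hxn (x' - x)
      convert this using 1 <;> abel
    · rw [← h]; abel
    · rw [← h]; abel
  -- the case analysis on the chain outcomes
  rcases hout with ⟨-, -, h1⟩ | ⟨-, -, O12, O21⟩ | ⟨-, -, O123, O321⟩
  · by_cases hx : (k : ℤ) ∣ x d
    · exact residx hx h1
    · exact good₀ _ (post₁_adm hx) h1
  · by_cases hx : (k : ℤ) ∣ x d
    · rcases O21 with h | h
      · exact good₀ _ rail_adm h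
      · rcases O12 with h' | h'
        · exact residx hx h'
        · exact good {s(x, x + n)} _ (singleton_subset_iff.2 hm₁) rail_adm h'
    · rcases O12 with h | h
      · exact good₀ _ (post₁_adm hx) h
      · exact good {s(x, x + n)} _ (singleton_subset_iff.2 hm₁) rail_adm h
  · by_cases hx : (k : ℤ) ∣ x d
    · have hx' := hnot_both hx
      rcases O321 with h | h | h
      · exact good₀ _ (post₃_adm hx') h
      · exact good {s(x' + n, x')} _ (singleton_subset_iff.2 hm₃) rail_adm h
      · rcases O123 with h' | h' | h'
        · exact residx hx h'
        · exact good {s(x, x + n)} _ (singleton_subset_iff.2 hm₁) rail_adm h'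
        · exact good {s(x, x + n), s(x + n, x' + n)} _
            (insert_subset hm₁ (singleton_subset_iff.2 hm₂)) (post₃_adm hx') h'
    · by_cases hx' : (k : ℤ) ∣ x' d
      · rcases O123 with h | h | h
        · exact good₀ _ (post₁_adm hx) h
        · exact good {s(x, x + n)} _ (singleton_subset_iff.2 hm₁) rail_adm h
        · rcases O321 with h' | h' | h'
          · exact residx' hx' h'
          · exact good {s(x' + n, x')} _ (singleton_subset_iff.2 hm₃) rail_adm h'
          · exact good {s(x' + n, x'), s(x + n, x' + n)} _
              (insert_subset hm₃ (singleton_subset_iff.2 hm₂)) (post₁_adm hx) h'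
      · rcases O123 with h | h | h
        · exact good₀ _ (post₁_adm hx) h
        · exact good {s(x, x + n)} _ (singleton_subset_iff.2 hm₁) rail_adm h
        · exact good {s(x, x + n), s(x + n, x' + n)} _
            (insert_subset hm₁ (singleton_subset_iff.2 hm₂)) (post₃_adm hx') h

end Summit.CriticalPhenomena.CardyFormulaZ2.Theorems.CardySelfRefinement

end
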